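import Summits.Ventures.HSemireg.WedgePointPairPowers

/-!
# Venture HSemireg — THEOREM T′ (DEGENERATE PAIRS / sub-torus ideals): the rank polynomial `(1+t)^b · P_{n−b}(t)`, every `n`, `b`, `k`

HONEST FRAMING. Part of the Lean index of the computation cell `pub-hsemireg` (seat p10 gen 6, Sunday typer «UNIFORM-IN-n»).
Finite-dimensional EXTERIOR ALGEBRA over a field ONLY: no variety, no cohomology theory, no sheaf, no Ext group and no
semiregularity map is constructed here; nothing here says that HC / HC_CM / HC_AV holds; no Literature fact is declared or used.
Custodian versions cited: theory/FORMULA-N.md PART A §2.5 «THEOREM T′ (DEGENERATE pairs) and sub-torus ideals» (th-6, v1.1) and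
§9b cross-reference row C-SUB («sub-abelian ideals I_B: (1+t)^b·P_{n−b}(t)»); STRUCTURE.md v1.0-SIGNED 9b196a05977dd067 §1.2 P4
(coordinate sub-tori as calibration objects).

WHAT TH-6 STATES (§2.5, quoted): if `κ = c₁·vol(K₁)Ω + c₂·vol(K₂)Ω` with `dim(K₁ ∩ K₂) = b` («degenerate pair»; `K_j` of dimension
`n` in `N_X`, `dim N_X = 2n`), write `K_j = I ⊕ K_j′`, `N_X = I ⊕ K₁′ ⊕ K₂′ ⊕ C` (`dim I = dim C = b`, `dim K_j′ = n − b`); then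
`θ ∧ f = (θ mod I) ∧ vol(I) ∧ (c₁ vol K₁′ + c₂ vol K₂′)` with the factor `⋀C` inert, so the rank polynomial of `θ ↦ θ⌟κ` is
`(1+t)^b · P_{n−b}(t)` — THEOREM T in dimension `n − b` times the free factor.  EXAMPLE: `κ = ch(I_B) = 1 − [B]` for a translate
`B ⊂ X` of a `b`-dimensional sub-torus; `b = 0` = the point `P_n`, `b = n − 1` = a divisor `(1+t)ⁿ`; instances `(1,5,5,1)` (an
elliptic curve in a threefold = t-13's `I_{E×pt×pt}`), `(1,7,12,7,1)`, `(1,6,10,6,1)`, `(1,4,6,4,1)` (`n = 4`, `b = 1,2,3`).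

WHAT THIS FILE PROVES (kernel; the block form, i.e. AFTER th-6's choice of a basis adapted to `I ⊕ K₁′ ⊕ K₂′ ⊕ C` — that choice
is the dictionary step and stays on paper, exactly as for THEOREM T in `WedgePairRank.lean`), in the sign-free wedge model of
`WedgeModel.lean` / `WedgeKunneth.lean`:
* §1 THE MONOMIAL-IN-A-BLOCK FACTOR LAW (generic generators `I`, any block `D`, any monomial `E_J`): the factor rank space
  `V_D(E_J, k)` is spanned by the distinct monomials `E_{s ∪ J}`, `s ⊆ D ∖ J`, `|s| = k`, so `dim V_D(E_J, k) = C(|D ∖ J|, k)` and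
  **`rankPoly_D(E_J) = (1+t)^{|D ∖ J|}`** (`rankPoly_B`); edges: the INERT block `rankPoly_D(1) = (1+t)^{|D|}` and the FULL
  monomial `rankPoly_D(E_D) = 1`.
* §2 GLUE: `rankPoly_emb` (an embedded class has its intrinsic rank polynomial on the image block) and THEOREM T as a rank
  polynomial, `rankPoly(a·E_X + c·E_Y) = pairPoly m` (`= P_m`, `WedgePointPairPowers.pairPoly`).
* §3 THE DEGENERATE-PAIR MODEL on `Fin ((c+c) + d)`: the PAIR block (first `2c` generators, th-7's point pair `a·E_{X′} + c′·E_{Y′}`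
  embedded) and the TORUS block (last `d` generators) carrying the monomial `E_T`, `T` any set of torus directions; the class
  `degPair a c′ T := (a·E_{X′} + c′·E_{Y′}) ∧ E_T`.  **`rankPoly_degPair`: its rank polynomial is `pairPoly c · (1+t)^{d − |T|}`**
  (Künneth `rankPoly_mul` × §1 × §2), hence **`finrank_range_wedge_degPair`**: `rank(θ ↦ θ ∧ degPair ∣ ⋀^k) = tPrimeRank c (d−|T|) k`
  `= Σ_{i ≤ k} r_i(c)·C(d − |T|, k − i)` for EVERY `c ≥ 1`, `d`, `T`, `k`, and in `ℤ[X]` with th-6's `P`: `= [t^k] (1+t)^{d−|T|}·P_c(t)`.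
* §4 THEOREM T′ AS PRINTED: `d = b + b`, `|T| = b` (`I = T`, `C` = the other `b` torus directions), `c = n − b ≥ 1`:
  **`theoremTprime`: `rank = [t^k] (1+t)^b · P_c(t)`** for every `c ≥ 1`, `b`, `k` (read `n = c + b`); the DIVISOR edge `c = 1`:
  `(1+t)^{b+1}` (`pairPoly_one`, `tPrimeRank_one`); the POINT edge `b = 0`: `r_k(c)` (`tPrimeRank_zero`); th-6's four instance rows
  by `decide` (`tPrimeRank_rows`).
NOT HERE (honest): the Ext side (th-6's THEOREM E′: `Ext•(I_B, I_B) = (1+t)^b P_{n−b}` and the squeeze ⇒ σ injective) — by value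
only, as in every p10 file; the coordinate-free form of T′ (arbitrary `K₁, K₂ ⊂ N` with `dim K₁ ∩ K₂ = b`) = the dictionary step.
Namespace `Summit.Ventures.HSemireg.Wedge.DegeneratePair` (new); new names only, nothing restated.
-/

open Module Set Set.powersetCard Polynomial

namespace Summit.Ventures.HSemireg.Wedge.DegeneratePair

open Summit.Ventures.HSemireg.Wedge Summit.Ventures.HSemireg.Wedge.Kunneth

variable (K : Type*) [Field K] {I : Type*} [LinearOrder I] [Fintype I]

/-! ## §1. A monomial inside a block: `rankPoly_D(E_J) = (1+t)^{|D ∖ J|}` -/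

section Monomial

variable {D J : Finset I}

/-- the factor rank space of the monomial `E_J` in the block `D` is spanned by the monomials `E_{s ∪ J}`, `s ⊆ D ∖ J`, `|s| = k`
(an `E_s ∧ E_J` with `s` meeting `J` vanishes; the others are unit multiples of `E_{s ∪ J}`). -/
lemma V_B_eq_span (k : ℕ) :
    V K I D (B K I J) k =
      Submodule.span K (Set.range fun s : (D \ J).powersetCard k => B K I ((s : Finset I) ∪ J)) := by
  apply le_antisymm
  · rw [V, Submodule.span_le]
    rintro _ ⟨s, ⟨hsD, hsk⟩, rfl⟩
    rw [SetLike.mem_coe]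
    show B K I s * B K I J ∈ _
    rw [B_mul_B]
    by_cases h : Disjoint s J
    · apply Submodule.smul_mem
      apply Submodule.subset_span
      refine ⟨⟨s, Finset.mem_powersetCard.mpr ⟨?_, hsk⟩⟩, rfl⟩
      intro x hx
      exact Finset.mem_sdiff.mpr ⟨hsD hx, fun hxJ => Finset.disjoint_left.mp h hx hxJ⟩
    · rw [u_eq_zero K h, zero_smul]
      exact Submodule.zero_mem _
  · rw [Submodule.span_le]
    rintro _ ⟨s, rfl⟩
    obtain ⟨hs, hsk⟩ := Finset.mem_powersetCard.mp s.2
    rw [SetLike.mem_coe]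
    have hdisj : Disjoint (s : Finset I) J := by
      rw [Finset.disjoint_left]
      intro x hx
      exact (Finset.mem_sdiff.mp (hs hx)).2
    have h : B K I ((s : Finset I) ∪ J) = (u K (s : Finset I) J)⁻¹ • (B K I s * B K I J) := by
      rw [B_mul_B, smul_smul, inv_mul_cancel₀ ((u_ne_zero_iff K).mpr hdisj), one_smul]
    show B K I ((s : Finset I) ∪ J) ∈ V K I D (B K I J) k
    rw [h, V]
    apply Submodule.smul_mem
    apply Submodule.subset_span
    exact ⟨s, ⟨fun x hx => (Finset.mem_sdiff.mp (hs hx)).1, hsk⟩, rfl⟩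

/-- the monomials `E_{s ∪ J}`, `s ⊆ D ∖ J`, `|s| = k`, are linearly independent (they are DISTINCT basis vectors: `s` is recovered
from `s ∪ J` as its part outside `J`). -/
lemma linearIndependent_B_union (k : ℕ) :
    LinearIndependent K (fun s : (D \ J).powersetCard k => B K I ((s : Finset I) ∪ J)) := by
  have hinj : Function.Injective (fun s : (D \ J).powersetCard k => (s : Finset I) ∪ J) := by
    intro s t h
    apply Subtype.ext
    have hs := (Finset.mem_powersetCard.mp s.2).1
    have ht := (Finset.mem_powersetCard.mp t.2).1
    simp only at h
    ext x
    constructor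
    · intro hx
      have hxJ : x ∉ J := (Finset.mem_sdiff.mp (hs hx)).2
      have h' : x ∈ (t : Finset I) ∪ J := h ▸ Finset.mem_union_left J hx
      exact (Finset.mem_union.mp h').resolve_right hxJ
    · intro hx
      have hxJ : x ∉ J := (Finset.mem_sdiff.mp (ht hx)).2
      have h' : x ∈ (s : Finset I) ∪ J := h.symm ▸ Finset.mem_union_left J hx
      exact (Finset.mem_union.mp h').resolve_right hxJ
  exact (B K I).linearIndependent.comp _ hinj

/-- **`dim V_D(E_J, k) = C(|D ∖ J|, k)`**: the factor rank of a monomial in a block counts the `k`-subsets of the free letters. -/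
theorem finrank_V_B (k : ℕ) : finrank K (V K I D (B K I J) k) = ((D \ J).card).choose k := by
  rw [V_B_eq_span, finrank_span_eq_card (linearIndependent_B_union K k), Fintype.card_coe, Finset.card_powersetCard]

/-- **THE MONOMIAL-IN-A-BLOCK FACTOR LAW: `rankPoly_D(E_J) = (1+t)^{|D ∖ J|}`** (every block `D`, every monomial `E_J`). -/
theorem rankPoly_B (D J : Finset I) : rankPoly K I D (B K I J) = (1 + X) ^ (D \ J).card := by
  ext k
  rw [coeff_rankPoly, finrank_V_B, coeff_one_add_X_pow, Nat.cast_id]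

/-- the INERT block: **`rankPoly_D(1) = (1+t)^{|D|}`** (`θ ↦ θ ∧ 1` is injective on `⋀(K^D)`; th-6's «free factor `⋀C`»). -/
theorem rankPoly_one (D : Finset I) : rankPoly K I D 1 = (1 + X) ^ D.card := by
  have h : B K I (∅ : Finset I) = 1 := by
    rw [B, ExteriorAlgebra.basis_apply_ofCard (b K I) Finset.card_empty]
    simp [ExteriorAlgebra.ιMulti_family]
  rw [← h, rankPoly_B, Finset.sdiff_empty]

/-- the FULL monomial of a block: **`rankPoly_D(E_D) = 1`** (only `θ = 1` survives; th-6's «`vol(I)`» factor). -/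
theorem rankPoly_B_self (D : Finset I) : rankPoly K I D (B K I D) = 1 := by
  rw [rankPoly_B, Finset.sdiff_self, Finset.card_empty, pow_zero]

end Monomial

/-! ## §2. Glue: embedded classes keep their rank polynomial; THEOREM T as a rank polynomial -/

section Glue

variable {J : Type*} [LinearOrder J] [Fintype J] (φ : J ↪o I)

/-- **GLUE for rank polynomials**: the rank polynomial of an embedded class on its image block is its INTRINSIC rank polynomial
(coefficientwise `finrank_V_emb`). -/
theorem rankPoly_emb (f₀ : HT K J) :
    rankPoly K I (Finset.univ.map φ.toEmbedding) (emb K φ f₀) = rankPoly K J Finset.univ f₀ := by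
  ext k
  rw [coeff_rankPoly, coeff_rankPoly, finrank_V_emb, V_univ]

end Glue

/-- **THEOREM T as a rank polynomial**: th-7's point pair `a·E_X + c·E_Y` on `2m` generators has intrinsic rank polynomial
`pairPoly m` (`= P_m = 2(1+t)^m − 1 − t^m`; `m ≥ 1`, `a, c ≠ 0`; `WedgePair.finrank_range_wedgeMap_pointPair` coefficientwise). -/
theorem rankPoly_pp {m : ℕ} (hm : 1 ≤ m) {a c : K} (ha : a ≠ 0) (hc : c ≠ 0) :
    rankPoly K (Fin (m + m)) Finset.univ (PairPowers.pp K m a c) = PairPowers.pairPoly m := by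
  ext k
  rw [coeff_rankPoly, V_univ, PairPowers.coeff_pairPoly]
  split_ifs with hk
  · exact WedgePair.finrank_range_wedgeMap_pointPair K (by omega) hk ha hc
  · rw [PairPowers.range_wedge_pp_eq_bot K (by omega), finrank_bot]

/-! ## §3. The degenerate-pair model on `Fin ((c+c) + d)` -/

section Model

variable (c d : ℕ)

/-- the PAIR block: the first `2c` generators (th-6's transverse parts `K₁′ ⊕ K₂′`, th-7's `X′ ⊔ Y′`). -/
def Pb : Finset (Fin ((c + c) + d)) := Finset.univ.map (Fin.castAddOrderEmb d).toEmbedding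

/-- the TORUS block: the last `d` generators (th-6's `I ⊕ C`: the common part of the pair and the inert complement). -/
def Tb : Finset (Fin ((c + c) + d)) := Finset.univ.map (Fin.natAddOrderEmb (c + c)).toEmbedding

/-- membership in the pair block by value: index `< 2c`. -/
lemma mem_Pb {x : Fin ((c + c) + d)} : x ∈ Pb c d ↔ (x : ℕ) < c + c := by
  rw [Pb, Finset.mem_map]
  constructor
  · rintro ⟨j, -, rfl⟩
    simp only [RelEmbedding.coe_toEmbedding, Fin.castAddOrderEmb_apply, Fin.val_castAdd]
    exact j.2
  · intro h
    refine ⟨⟨x, h⟩, Finset.mem_univ _, Fin.ext ?_⟩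
    simp only [RelEmbedding.coe_toEmbedding, Fin.castAddOrderEmb_apply, Fin.val_castAdd]

/-- membership in the torus block by value: index `≥ 2c`. -/
lemma mem_Tb {x : Fin ((c + c) + d)} : x ∈ Tb c d ↔ c + c ≤ (x : ℕ) := by
  rw [Tb, Finset.mem_map]
  constructor
  · rintro ⟨j, -, rfl⟩
    simp only [RelEmbedding.coe_toEmbedding, Fin.natAddOrderEmb_apply, Fin.val_natAdd]
    exact Nat.le_add_right _ _
  · intro h
    have hx := x.2
    refine ⟨⟨x - (c + c), by omega⟩, Finset.mem_univ _, Fin.ext ?_⟩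
    simp only [RelEmbedding.coe_toEmbedding, Fin.natAddOrderEmb_apply, Fin.val_natAdd]
    omega

/-- the two blocks are disjoint. -/
lemma disjoint_Pb_Tb : Disjoint (Pb c d) (Tb c d) := by
  rw [Finset.disjoint_left]
  intro x h1 h2
  rw [mem_Pb] at h1
  rw [mem_Tb] at h2
  omega

/-- the two blocks cover the generators. -/
lemma Pb_union_Tb : Pb c d ∪ Tb c d = Finset.univ := by
  ext x
  simp only [Finset.mem_union, mem_Pb, mem_Tb, Finset.mem_univ, iff_true]
  omega

/-- the torus block has `d` letters. -/
lemma card_Tb : (Tb c d).card = d := by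
  rw [Tb, Finset.card_map, Finset.card_univ, Fintype.card_fin]

variable {c d}

/-- a set `T` of torus directions, as a set of generators of the big model. -/
def torus (T : Finset (Fin d)) : Finset (Fin ((c + c) + d)) := T.map (Fin.natAddOrderEmb (c + c)).toEmbedding

/-- `torus T` lies in the torus block and has `|T|` letters. -/
lemma torus_subset_Tb (T : Finset (Fin d)) : torus (c := c) T ⊆ Tb c d ∧ (torus (c := c) T).card = T.card :=
  ⟨Finset.map_subset_map.mpr (Finset.subset_univ T), Finset.card_map _⟩

/-- **the DEGENERATE PAIR class** `degPair a c′ T := (a·E_{X′} + c′·E_{Y′}) ∧ E_T` on `⋀ K^{(c+c)+d}`: th-7's point pair of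
dimension `c` on the pair block times the monomial of the torus directions `T` (model of `c₁ vol(K₁) + c₂ vol(K₂)` with
`K₁ ∩ K₂ = ⟨T⟩`, `K_j = ⟨T⟩ ⊕ K_j′`; e.g. `ch(I_B) = 1 − [B]` up to units, `B` a translate of a sub-torus with tangent directions `T`). -/
noncomputable def degPair (a c' : K) (T : Finset (Fin d)) : HT K (Fin ((c + c) + d)) :=
  emb K (Fin.castAddOrderEmb d) (PairPowers.pp K c a c') * B K (Fin ((c + c) + d)) (torus T)

/-- the pair part is homogeneous of degree `c` on the pair block. -/
lemma pair_mem_Hom (a c' : K) :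
    emb K (Fin.castAddOrderEmb d) (PairPowers.pp K c a c') ∈ Hom K (Fin ((c + c) + d)) (Pb c d) c :=
  emb_mem_Hom K _ (PairPowers.pp_mem_Hom K c a c')

/-- the torus monomial is homogeneous of degree `|T|` on the torus block. -/
lemma torus_mem_Hom (T : Finset (Fin d)) :
    B K (Fin ((c + c) + d)) (torus (c := c) T) ∈ Hom K (Fin ((c + c) + d)) (Tb c d) T.card :=
  B_mem_Hom K (torus_subset_Tb T).1 (torus_subset_Tb T).2

/-- **THE RANK POLYNOMIAL OF A DEGENERATE PAIR is `P_c(t) · (1+t)^{d − |T|}`** (`c ≥ 1`, `a, c′ ≠ 0`; every `d`, `T`): Künneth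
(`rankPoly_mul`) × THEOREM T on the pair block (`rankPoly_pp`, glued by `rankPoly_emb`) × the monomial-in-a-block law on the torus
block (`rankPoly_B`: the `d − |T|` free torus letters). -/
theorem rankPoly_degPair (hc : 1 ≤ c) {a c' : K} (ha : a ≠ 0) (hc' : c' ≠ 0) (T : Finset (Fin d)) :
    rankPoly K (Fin ((c + c) + d)) Finset.univ (degPair K a c' T) = PairPowers.pairPoly c * (1 + X) ^ (d - T.card) := by
  rw [← Pb_union_Tb c d, degPair, rankPoly_mul K (disjoint_Pb_Tb c d) (pair_mem_Hom K a c') (torus_mem_Hom K T), Pb,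
    rankPoly_emb, rankPoly_pp K hc ha hc', rankPoly_B, Finset.card_sdiff_of_subset (torus_subset_Tb T).1, card_Tb,
    (torus_subset_Tb T).2]

/-- **computable closed form `tPrimeRank c b k := Σ_{i ≤ k} r_i(c) · C(b, k − i)`** (`r_i(c) = 2C(c,i) − [i=0] − [i=c]` for `i ≤ c`,
`0` above) `= [t^k] P_c(t)·(1+t)^b`. -/
def tPrimeRank (c b k : ℕ) : ℕ :=
  ∑ i ∈ Finset.range (k + 1), (if i ≤ c then WedgePair.pointPairRank c i else 0) * b.choose (k - i)

/-- `[t^k] pairPoly c · (1+t)^b = tPrimeRank c b k`. -/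
lemma coeff_pairPoly_mul (c b k : ℕ) : (PairPowers.pairPoly c * (1 + X) ^ b).coeff k = tPrimeRank c b k := by
  rw [coeff_mul, Finset.Nat.sum_antidiagonal_eq_sum_range_succ
    (fun i j => (PairPowers.pairPoly c).coeff i * ((1 + X : Polynomial ℕ) ^ b).coeff j) k, tPrimeRank]
  refine Finset.sum_congr rfl fun i _ => ?_
  rw [PairPowers.coeff_pairPoly, coeff_one_add_X_pow, Nat.cast_id]

/-- **THE RANK OF A DEGENERATE PAIR IN EVERY DEGREE**: `rank(θ ↦ θ ∧ degPair ∣ ⋀^k K^{(c+c)+d}) = tPrimeRank c (d − |T|) k`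
`= Σ_{i ≤ k} r_i(c)·C(d − |T|, k − i)` (`c ≥ 1`, `a, c′ ≠ 0`; every `d`, `T`, `k`). -/
theorem finrank_range_wedge_degPair (hc : 1 ≤ c) {a c' : K} (ha : a ≠ 0) (hc' : c' ≠ 0) (T : Finset (Fin d)) (k : ℕ) :
    finrank K (LinearMap.range (wedge K (Fin ((c + c) + d)) k (degPair K a c' T))) = tPrimeRank c (d - T.card) k := by
  rw [← V_univ, ← coeff_rankPoly, rankPoly_degPair K hc ha hc' T, coeff_pairPoly_mul]

/-- the same in `ℤ[X]` with th-6's `P_c = 2(1+t)^c − 1 − t^c` (`FormulaN.Uniform.P`): **`rank = [t^k] (1+t)^{d−|T|} · P_c(t)`**. -/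
theorem finrank_range_wedge_degPair_eq_coeff (hc : 1 ≤ c) {a c' : K} (ha : a ≠ 0) (hc' : c' ≠ 0) (T : Finset (Fin d))
    (k : ℕ) :
    (finrank K (LinearMap.range (wedge K (Fin ((c + c) + d)) k (degPair K a c' T))) : ℤ) =
      ((1 + X) ^ (d - T.card) * FormulaN.Uniform.P c).coeff k := by
  rw [finrank_range_wedge_degPair K hc ha hc' T k, ← coeff_pairPoly_mul]
  have h : (PairPowers.pairPoly c).map (Nat.castRingHom ℤ) = FormulaN.Uniform.P c := by
    ext j
    rw [coeff_map, eq_natCast, PairPowers.coeff_pairPoly_cast]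
  have h2 : (PairPowers.pairPoly c * (1 + X) ^ (d - T.card)).map (Nat.castRingHom ℤ) =
      (1 + X) ^ (d - T.card) * FormulaN.Uniform.P c := by
    rw [Polynomial.map_mul, Polynomial.map_pow, Polynomial.map_add, Polynomial.map_one, Polynomial.map_X, h, mul_comm]
  rw [← h2, coeff_map, eq_natCast]

end Model

/-! ## §4. THEOREM T′ as printed, the two edges, th-6's instance rows -/

/-- **THEOREM T′ (FORMULA-N PART A §2.5), every `n = c + b` with `c ≥ 1`, every `k`**: for a degenerate pair with common part of
dimension `b` — pair block of `2c` generators, torus block of `b + b` generators of which `T` (`|T| = b`) are the common directions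
`I` and the other `b` the inert `C` — **`rank(θ ↦ θ ∧ ((a·E_{X′} + c′·E_{Y′}) ∧ E_T) ∣ ⋀^k K^{2n}) = [t^k] (1+t)^b · P_c(t)`**,
`P_c = 2(1+t)^c − 1 − t^c` (th-6: «THEOREM T in dimension `n − b` times the free factor»; sub-torus ideals `I_B`, `dim B = b`). -/
theorem theoremTprime {c b : ℕ} (hc : 1 ≤ c) {a c' : K} (ha : a ≠ 0) (hc' : c' ≠ 0) (T : Finset (Fin (b + b)))
    (hT : T.card = b) (k : ℕ) :
    (finrank K (LinearMap.range (wedge K (Fin ((c + c) + (b + b))) k (degPair K a c' T))) : ℤ) =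
      ((1 + X) ^ b * FormulaN.Uniform.P c).coeff k := by
  rw [finrank_range_wedge_degPair_eq_coeff K hc ha hc' T k, hT, Nat.add_sub_cancel]

/-- THEOREM T for `m = 1` as a polynomial: `pairPoly 1 = 1 + t` (`r_0(1) = r_1(1) = 1`). -/
theorem pairPoly_one : PairPowers.pairPoly 1 = 1 + X := by
  ext k
  rw [PairPowers.coeff_pairPoly, coeff_add, coeff_one, coeff_X]
  rcases Nat.lt_or_ge k 2 with h | h
  · interval_cases k <;> simp [WedgePair.pointPairRank]
  · rw [if_neg (by omega), if_neg (by omega), if_neg (by omega), add_zero]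

/-- **the DIVISOR edge `c = 1`** (th-6: «`b = n − 1`: divisor `(1+t)ⁿ`»): a degenerate pair with ONE transverse dimension has rank
polynomial `(1+t)^{d − |T| + 1}` — `θ ↦ θ ∧ degPair` has the rank profile of a single pure class (`a, c′ ≠ 0`; every `d`, `T`). -/
theorem rankPoly_degPair_one {d : ℕ} {a c' : K} (ha : a ≠ 0) (hc' : c' ≠ 0) (T : Finset (Fin d)) :
    rankPoly K (Fin ((1 + 1) + d)) Finset.univ (degPair K a c' T) = (1 + X) ^ (d - T.card + 1) := by
  rw [rankPoly_degPair K le_rfl ha hc' T, pairPoly_one, pow_succ, mul_comm]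

/-- the divisor edge numerically: `tPrimeRank 1 b k = C(b+1, k)` (Pascal). -/
theorem tPrimeRank_one (b k : ℕ) : tPrimeRank 1 b k = (b + 1).choose k := by
  rw [← coeff_pairPoly_mul, pairPoly_one, ← pow_succ', coeff_one_add_X_pow, Nat.cast_id]

/-- **the POINT edge `b = 0`** (no torus letters free): `tPrimeRank c 0 k = r_k(c)` for `k ≤ c` and `0` above — THEOREM T itself. -/
theorem tPrimeRank_zero (c k : ℕ) : tPrimeRank c 0 k = if k ≤ c then WedgePair.pointPairRank c k else 0 := by
  rw [← coeff_pairPoly_mul, pow_zero, mul_one, PairPowers.coeff_pairPoly]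

/-- **th-6's four instance rows of §2.5, by `decide` from the closed form**: `(c, b) = (2, 1)` (an elliptic curve in an abelian
threefold, t-13's `I_{E×pt×pt}`): `(1,5,5,1)`; `n = 4`: `(c, b) = (3, 1)`: `(1,7,12,7,1)`, `(2, 2)`: `(1,6,10,6,1)`, `(1, 3)`:
`(1,4,6,4,1)` — each `= [t^k] (1+t)^b P_c(t)` (`MODEL fn_subtorus.py ✓ all`, now kernel). -/
theorem tPrimeRank_rows :
    (tPrimeRank 2 1 0, tPrimeRank 2 1 1, tPrimeRank 2 1 2, tPrimeRank 2 1 3, tPrimeRank 2 1 4) = (1, 5, 5, 1, 0) ∧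
    (tPrimeRank 3 1 0, tPrimeRank 3 1 1, tPrimeRank 3 1 2, tPrimeRank 3 1 3, tPrimeRank 3 1 4, tPrimeRank 3 1 5) =
      (1, 7, 12, 7, 1, 0) ∧
    (tPrimeRank 2 2 0, tPrimeRank 2 2 1, tPrimeRank 2 2 2, tPrimeRank 2 2 3, tPrimeRank 2 2 4, tPrimeRank 2 2 5) =
      (1, 6, 10, 6, 1, 0) ∧
    (tPrimeRank 1 3 0, tPrimeRank 1 3 1, tPrimeRank 1 3 2, tPrimeRank 1 3 3, tPrimeRank 1 3 4, tPrimeRank 1 3 5) =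
      (1, 4, 6, 4, 1, 0) := by
  decide

/-- the instance rows as RANK statements (every field, `a, c′ ≠ 0`): an elliptic curve in an abelian threefold — the class
`(a·E_{X′} + c′·E_{Y′}) ∧ E_T` with `c = 2`, one common direction `T = {0}` of a torus block of two — has wedge ranks `(1, 5, 5, 1)`
on `⋀⁰, …, ⋀³` of `K⁶`. -/
theorem finrank_range_wedge_degPair_threefold_curve {a c' : K} (ha : a ≠ 0) (hc' : c' ≠ 0) :
    (finrank K (LinearMap.range (wedge K (Fin ((2 + 2) + (1 + 1))) 0 (degPair K a c' ({0} : Finset (Fin (1 + 1)))))),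
      finrank K (LinearMap.range (wedge K (Fin ((2 + 2) + (1 + 1))) 1 (degPair K a c' ({0} : Finset (Fin (1 + 1)))))),
      finrank K (LinearMap.range (wedge K (Fin ((2 + 2) + (1 + 1))) 2 (degPair K a c' ({0} : Finset (Fin (1 + 1)))))),
      finrank K (LinearMap.range (wedge K (Fin ((2 + 2) + (1 + 1))) 3 (degPair K a c' ({0} : Finset (Fin (1 + 1))))))) =
      (1, 5, 5, 1) := by
  simp only [finrank_range_wedge_degPair K (show 1 ≤ 2 by norm_num) ha hc', Finset.card_singleton]
  decide

end Summit.Ventures.HSemireg.Wedge.DegeneratePair
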